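import Summits.AtomisticToContinuum.HydrodynamicLimit.Theorems.OneFlightGossipEngineEquilibriumClampedCollisionalWindowLDDefs
import Literature.Analysis.FluidPDE.HardSphereTrajectoryMeasurable
import Literature.MathematicalPhysics.KineticTheory.HardSphereBBGKYLiouvilleFlow

/-!
# Stub `stub_orbitIntegrable` of the line `radial-virial-polarization` (crux `EquilibriumClampedCollisionalWindowLD`)

Proof file (`--supports stmt-AtomisticToContinuum-13733`) of the registered stub S7 `stub_orbitIntegrable` of the
lead's skeleton `Cruxes/EquilibriumClampedCollisionalWindowLD/Lines/radial_virial_polarization.lean` (line lead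
`prover-line-stmt-AtomisticToContinuum-13733-c2-0`), over the landed vocabulary
`…Theorems.OneFlightGossipEngineEquilibriumClampedCollisionalWindowLDDefs` (namespace
`Summit.AtomisticToContinuum.HydrodynamicLimit.Theorems.ClampedTransferCoin`: `Flow`, `Phase`, `window`).

**Statement.** For a hard-sphere flow `Φ` of `N + 1` spheres on `𝕋³`, a GOOD initial datum `z ∈ Φ.good` and a
CONTINUOUS observable `F : Phase N → ℝ`, the function `r ↦ F (Φ_r z)` is interval integrable on the kinetic
window `[0, w]`, `w = τ (N+1)^{-1/3}` (indeed on every bounded interval, `intervalIntegrable_comp_flow`). This is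
what the composition of the line needs to split the EOS window integrals `∫₀ʷ Σ_i ψ(x_i(r)) (…) dr` linearly.

**Proof (boundedness + measurability).** The orbit `r ↦ Φ_r z` of a good datum is a hard-sphere trajectory,
hence Borel measurable in time (`IsHardSphereTrajectory.measurable_torus`: right-continuity and dyadic
approximation), so `F ∘ orbit` is measurable. The kinetic energy is conserved along the orbit
(`HardSphereFlow.configEnergy_flow`), so every speed stays `≤ √(2 E(z))` and the orbit lies in the compact set
`K = ∏_i (𝕋³ × B̄(0, √(2E(z))))`; the continuous `F` is bounded on `K`, and a bounded measurable function on a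
finite interval is integrable (`IntegrableOn.of_bound`).

References: C. Cercignani, R. Illner, M. Pulvirenti, *The Mathematical Theory of Dilute Gases* (1994), §4.2
(energy conservation, time averages along the hard-sphere flow); I. Gallagher, L. Saint-Raymond, B. Texier,
*From Newton to Boltzmann* (2013), §4.1 (trajectories are right-continuous, piecewise free flight).
-/

noncomputable section

open MeasureTheory Set Filter
open scoped ENNReal BigOperators
open Literature.Analysis.FluidPDE Literature.MathematicalPhysics.KineticTheory
open Literature.Analysis.FunctionSpaces (Torus.partialDeriv Torus.IsSmooth)

namespace Summit.AtomisticToContinuum.HydrodynamicLimit.Theorems.ClampedTransferCoin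

namespace RadialVirial

/-- Each speed is controlled by the kinetic energy: `‖v_i‖ ≤ √(2 E(y))`. -/
theorem norm_vel_le_sqrt_configEnergy {N : ℕ} (y : Phase N) (i : Fin (N + 1)) :
    ‖(y i).2‖ ≤ Real.sqrt (2 * configEnergy y) := by
  have h : ‖(y i).2‖ ^ 2 ≤ ∑ j, ‖(y j).2‖ ^ 2 :=
    Finset.single_le_sum (f := fun j => ‖(y j).2‖ ^ 2) (fun j _ => sq_nonneg _) (Finset.mem_univ i)
  have h2 : ‖(y i).2‖ ^ 2 ≤ 2 * configEnergy y := by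
    unfold configEnergy
    linarith
  exact (le_abs_self _).trans (Real.abs_le_sqrt h2)

/-- The energy shell box `K_E = ∏_i (𝕋³ × B̄(0, √(2E)))` of phase space is compact (the torus is compact). -/
theorem isCompact_energyBox (N : ℕ) (E : ℝ) :
    IsCompact (Set.pi Set.univ fun _ : Fin (N + 1) =>
      (Set.univ : Set T3) ×ˢ Metric.closedBall (0 : V3) (Real.sqrt (2 * E))) :=
  isCompact_univ_pi fun _ => isCompact_univ.prod (isCompact_closedBall _ _)

/-- A good orbit stays in the energy shell box of its initial energy (conservation of energy along the flow). -/
theorem flow_mem_energyBox {σ : ℝ} {N : ℕ} (Φ : Flow σ N) {z : Phase N} (hz : z ∈ Φ.good) (t : ℝ) :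
    Φ.flow t z ∈ Set.pi Set.univ fun _ : Fin (N + 1) =>
      (Set.univ : Set T3) ×ˢ Metric.closedBall (0 : V3) (Real.sqrt (2 * configEnergy z)) := by
  refine Set.mem_univ_pi.2 fun i => ⟨Set.mem_univ _, ?_⟩
  rw [mem_closedBall_zero_iff, ← Φ.configEnergy_flow hz t]
  exact norm_vel_le_sqrt_configEnergy _ i

/-- A good orbit of a hard-sphere flow on `𝕋³` is Borel measurable in time. -/
theorem measurable_flow_orbit {σ : ℝ} {N : ℕ} (Φ : Flow σ N) {z : Phase N} (hz : z ∈ Φ.good) :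
    Measurable fun t : ℝ => Φ.flow t z :=
  (Φ.isTrajectory z hz).measurable_torus

/-- **Continuous observables are interval integrable along good orbits**: for `z ∈ Φ.good` and a continuous
`F : Phase N → ℝ`, `r ↦ F (Φ_r z)` is interval integrable on every `[a, b]` (bounded — the orbit lies in a compact
energy box — and measurable). -/
theorem intervalIntegrable_comp_flow {σ : ℝ} {N : ℕ} (Φ : Flow σ N) {z : Phase N} (hz : z ∈ Φ.good)
    {F : Phase N → ℝ} (hF : Continuous F) (a b : ℝ) :
    IntervalIntegrable (fun r => F (Φ.flow r z)) volume a b := by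
  obtain ⟨C, hC⟩ := (isCompact_energyBox N (configEnergy z)).exists_bound_of_continuousOn hF.continuousOn
  have hmeas : Measurable fun r => F (Φ.flow r z) := hF.measurable.comp (measurable_flow_orbit Φ hz)
  rw [intervalIntegrable_iff]
  refine IntegrableOn.of_bound ?_ hmeas.aestronglyMeasurable C (ae_of_all _ fun r => hC _ (flow_mem_energyBox Φ hz r))
  rw [uIoc, Real.volume_Ioc]
  exact ENNReal.ofReal_lt_top

/-- **Stub S7 `stub_orbitIntegrable`** (registered signature): along a good orbit of the crux's hard-sphere flow,
every continuous observable is interval integrable on the kinetic window `[0, τ (N+1)^{-1/3}]`. -/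
theorem stub_orbitIntegrable :
    ∀ (σ τ : ℝ), 0 < σ → σ < 1 / 2 → 0 < τ → ∀ (N : ℕ) (Φ : Flow σ N), ∀ z ∈ Φ.good,
      ∀ F : Phase N → ℝ, Continuous F →
        IntervalIntegrable (fun r => F (Φ.flow r z)) volume 0 (window τ N) := by
  intro σ τ _ _ _ N Φ z hz F hF
  exact intervalIntegrable_comp_flow Φ hz hF 0 (window τ N)

end RadialVirial

end Summit.AtomisticToContinuum.HydrodynamicLimit.Theorems.ClampedTransferCoin

end
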